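import Summits.KontsevichZagierPeriods.KontsevichZagierPeriods.Theorems.LinRedNormalFormArrangementNormalFormSeparateTwoHIChart
import Summits.KontsevichZagierPeriods.KontsevichZagierPeriods.Theorems.LinRedNormalFormArrangementNormalFormSeparateThreeHIChart

/-!
# Nested thin sectors at a base point of `ℝ³`: the blow-up chart

(Line `janus-bands`, crux `ArrangementNormalForm`, stub `stub_separateHigh`, part `HHKChart` of
the wall-invariant termwise-split lemma `separateThree_hHk` in base dimension `3` with fibres.)
The measure-theoretic chart of the local analysis of the Taylor pieces at a point `z₁ ∈ ℝ³`.
For a frame `d, Q, S` of `ℝ³` (`det3 d Q S ≠ 0`) the NESTED THIN SECTOR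
`nsector z₁ d Q S δt δ J = {z₁ + t (d + v (Q + u S)) | t ∈ (0, δt), v ∈ (0, δ), u ∈ J}` is the
image of the box `nbox δt δ J` under the polynomial chart `nchart` (Jacobian `t² v · det3 d Q S`);
by the change of variables formula (`lintegral_image_eq_lintegral_abs_det_fderiv_mul`), the
product structure `ℝ³ ≅ ℝ² × ℝ` (`SepThree.chart3 0`) and the planar chart `SepTwo.lintegral_chart`,
`∫⁻_{nsector} G = |det3| ∫⁻_t ∫⁻_v ∫⁻_u t² v · G (npt z₁ d Q S t v u)` (`lintegral_nsector`,
registered as `separateThreeHHK_chart`). Also: membership, measurability, monotonicity and the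
version with `J = [0, ε)` (the wall `u = 0` is null). The sign lemma is in part `HHKSign`.
-/

noncomputable section

open Set MeasureTheory Filter Topology
open scoped ENNReal

namespace Summit.KontsevichZagierPeriods.ArrangementNormalForm.JanusBands

namespace SepHHK

open SepTwo

/-! ### The nested chart -/

/-- The point of the nested sector with blown-up coordinates `(t, v, u)`. -/
def npt (z₁ d Q S : Fin 3 → ℝ) (t v u : ℝ) : Fin 3 → ℝ :=
  fun i => z₁ i + t * (d i + v * (Q i + u * S i))

/-- The nested chart `w ↦ npt z₁ d Q S (w 0) (w 1) (w 2)`. -/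
def nchart (z₁ d Q S : Fin 3 → ℝ) (w : Fin 3 → ℝ) : Fin 3 → ℝ := npt z₁ d Q S (w 0) (w 1) (w 2)

/-- The box of blown-up coordinates. -/
def nbox (δt δ : ℝ) (J : Set ℝ) : Set (Fin 3 → ℝ) := {w | w 0 ∈ Ioo 0 δt ∧ w 1 ∈ Ioo 0 δ ∧ w 2 ∈ J}

/-- The nested thin sector. -/
def nsector (z₁ d Q S : Fin 3 → ℝ) (δt δ : ℝ) (J : Set ℝ) : Set (Fin 3 → ℝ) :=
  nchart z₁ d Q S '' nbox δt δ J

/-- The matrix with columns `d, Q, S`. -/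
def fmat (d Q S : Fin 3 → ℝ) : Matrix (Fin 3) (Fin 3) ℝ := Matrix.of fun i j => ![d i, Q i, S i] j

/-- The determinant of the frame. -/
def det3 (d Q S : Fin 3 → ℝ) : ℝ := (fmat d Q S).det

/-- The Jacobian matrix of the nested chart. -/
def jmat (d Q S w : Fin 3 → ℝ) : Matrix (Fin 3) (Fin 3) ℝ :=
  Matrix.of fun i j => ![d i + w 1 * (Q i + w 2 * S i), w 0 * (Q i + w 2 * S i), w 0 * w 1 * S i] j

/-- The derivative of the nested chart. -/
def nderiv (d Q S w : Fin 3 → ℝ) : (Fin 3 → ℝ) →L[ℝ] (Fin 3 → ℝ) :=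
  LinearMap.toContinuousLinearMap (Matrix.toLin' (jmat d Q S w))

/-- The determinant in coordinates. -/
theorem det3_eq (d Q S : Fin 3 → ℝ) : det3 d Q S =
    d 0 * (Q 1 * S 2 - Q 2 * S 1) - Q 0 * (d 1 * S 2 - d 2 * S 1) + S 0 * (d 1 * Q 2 - d 2 * Q 1) := by
  rw [det3, Matrix.det_fin_three]
  simp [fmat]
  ring

/-- The Jacobian determinant. -/
theorem det_jmat (d Q S w : Fin 3 → ℝ) : (jmat d Q S w).det = w 0 ^ 2 * w 1 * det3 d Q S := by
  rw [det3_eq, Matrix.det_fin_three]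
  simp [jmat]
  ring

/-- The determinant of the derivative. -/
theorem det_nderiv (d Q S w : Fin 3 → ℝ) : (nderiv d Q S w).det = w 0 ^ 2 * w 1 * det3 d Q S := by
  unfold nderiv
  rw [ContinuousLinearMap.det, LinearMap.coe_toContinuousLinearMap, LinearMap.det_toLin', det_jmat]

/-- The derivative in coordinates. -/
theorem nderiv_apply (d Q S w h : Fin 3 → ℝ) (i : Fin 3) :
    nderiv d Q S w h i = (d i + w 1 * (Q i + w 2 * S i)) * h 0 + w 0 * (Q i + w 2 * S i) * h 1 +
      w 0 * w 1 * S i * h 2 := by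
  simp [nderiv, jmat, Matrix.mulVec, dotProduct, Fin.sum_univ_three]

/-- The frame matrix in coordinates. -/
theorem fmat_mulVec (d Q S ξ : Fin 3 → ℝ) (i : Fin 3) :
    (fmat d Q S).mulVec ξ i = d i * ξ 0 + Q i * ξ 1 + S i * ξ 2 := by
  simp [fmat, Matrix.mulVec, dotProduct, Fin.sum_univ_three]

/-- **The nested chart is differentiable** with derivative `nderiv`. -/
theorem hasFDerivAt_nchart (z₁ d Q S w : Fin 3 → ℝ) :
    HasFDerivAt (nchart z₁ d Q S) (nderiv d Q S w) w := by
  refine hasFDerivAt_pi'' fun i => ?_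
  have h0 : HasFDerivAt (fun w : Fin 3 → ℝ => w 0) (ContinuousLinearMap.proj (R := ℝ) 0) w :=
    hasFDerivAt_apply (𝕜 := ℝ) 0 w
  have h1 : HasFDerivAt (fun w : Fin 3 → ℝ => w 1) (ContinuousLinearMap.proj (R := ℝ) 1) w :=
    hasFDerivAt_apply (𝕜 := ℝ) 1 w
  have h2 : HasFDerivAt (fun w : Fin 3 → ℝ => w 2) (ContinuousLinearMap.proj (R := ℝ) 2) w :=
    hasFDerivAt_apply (𝕜 := ℝ) 2 w
  have h3 := ((h2.mul_const (S i)).const_add (Q i))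
  have h4 := (h1.mul h3).const_add (d i)
  have h5 := (h0.mul h4).const_add (z₁ i)
  have h6 : HasFDerivAt (fun x => nchart z₁ d Q S x i)
      (w 0 • (w 1 • S i • ContinuousLinearMap.proj (R := ℝ) 2 +
          (Q i + w 2 * S i) • ContinuousLinearMap.proj (R := ℝ) 1) +
        (d i + w 1 * (Q i + w 2 * S i)) • ContinuousLinearMap.proj (R := ℝ) 0) w := h5
  refine h6.congr_fderiv (ContinuousLinearMap.ext fun h => ?_)
  show _ = nderiv d Q S w h i
  rw [nderiv_apply]
  simp
  ring

/-- **The nested chart is injective on the box** for a genuine frame. -/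
theorem nchart_injOn (z₁ d Q S : Fin 3 → ℝ) (hdet : det3 d Q S ≠ 0) (δt δ : ℝ) (J : Set ℝ) :
    InjOn (nchart z₁ d Q S) (nbox δt δ J) := by
  classical
  intro w hw w' hw' h
  have hc : ∀ i, w 0 * (d i + w 1 * (Q i + w 2 * S i)) = w' 0 * (d i + w' 1 * (Q i + w' 2 * S i)) := by
    intro i
    have := congr_fun h i
    simp only [nchart, npt, add_right_inj] at this
    exact this
  set ξ : Fin 3 → ℝ := ![w 0 - w' 0, w 0 * w 1 - w' 0 * w' 1, w 0 * w 1 * w 2 - w' 0 * w' 1 * w' 2]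
    with hξ
  have hmul : (fmat d Q S).mulVec ξ = 0 := by
    funext i
    rw [fmat_mulVec, Pi.zero_apply, hξ]
    simp only [Matrix.cons_val_zero, Matrix.cons_val_one, Matrix.cons_val_two, Matrix.head_cons,
      Matrix.tail_cons]
    linear_combination hc i
  have hξ0 : ξ = 0 := by
    by_contra hne
    exact hdet ((Matrix.exists_mulVec_eq_zero_iff).1 ⟨ξ, hne, hmul⟩)
  have e0 : w 0 - w' 0 = 0 := by simpa [hξ] using congr_fun hξ0 0
  have e1 : w 0 * w 1 - w' 0 * w' 1 = 0 := by simpa [hξ] using congr_fun hξ0 1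
  have e2 : w 0 * w 1 * w 2 - w' 0 * w' 1 * w' 2 = 0 := by simpa [hξ] using congr_fun hξ0 2
  have hw0 : w 0 = w' 0 := by linarith
  have hp0 : 0 < w 0 := hw.1.1
  have hp1 : 0 < w 1 := hw.2.1.1
  have hw1 : w 1 = w' 1 := by
    rw [← hw0] at e1
    have : w 0 * (w 1 - w' 1) = 0 := by linarith
    rcases mul_eq_zero.1 this with h | h
    · linarith
    · linarith
  have hw2 : w 2 = w' 2 := by
    rw [← hw0, ← hw1] at e2
    have : (w 0 * w 1) * (w 2 - w' 2) = 0 := by linarith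
    rcases mul_eq_zero.1 this with h | h
    · exact absurd h (mul_pos hp0 hp1).ne'
    · linarith
  funext i
  fin_cases i
  · exact hw0
  · exact hw1
  · exact hw2

/-- The box is measurable. -/
theorem measurableSet_nbox (δt δ : ℝ) {J : Set ℝ} (hJ : MeasurableSet J) :
    MeasurableSet (nbox δt δ J) := by
  have h : nbox δt δ J = ((fun w : Fin 3 → ℝ => w 0) ⁻¹' Ioo 0 δt ∩ (fun w : Fin 3 → ℝ => w 1) ⁻¹' Ioo 0 δ) ∩
      (fun w : Fin 3 → ℝ => w 2) ⁻¹' J := by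
    ext w; simp [nbox, and_assoc]
  rw [h]
  exact ((measurable_pi_apply 0 measurableSet_Ioo).inter (measurable_pi_apply 1 measurableSet_Ioo)).inter
    (measurable_pi_apply 2 hJ)

/-- The nested sector is measurable. -/
theorem measurableSet_nsector (z₁ d Q S : Fin 3 → ℝ) (hdet : det3 d Q S ≠ 0) (δt δ : ℝ)
    {J : Set ℝ} (hJ : MeasurableSet J) : MeasurableSet (nsector z₁ d Q S δt δ J) :=
  measurable_image_of_fderivWithin (measurableSet_nbox δt δ hJ)
    (fun w _ => (hasFDerivAt_nchart z₁ d Q S w).hasFDerivWithinAt) (nchart_injOn z₁ d Q S hdet δt δ J)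

/-- **Membership in the nested sector.** -/
theorem mem_nsector_iff (z₁ d Q S : Fin 3 → ℝ) (δt δ : ℝ) (J : Set ℝ) (z : Fin 3 → ℝ) :
    z ∈ nsector z₁ d Q S δt δ J ↔
      ∃ t ∈ Ioo 0 δt, ∃ v ∈ Ioo 0 δ, ∃ u ∈ J, z = npt z₁ d Q S t v u := by
  constructor
  · rintro ⟨w, ⟨h0, h1, h2⟩, rfl⟩
    exact ⟨w 0, h0, w 1, h1, w 2, h2, rfl⟩
  · rintro ⟨t, ht, v, hv, u, hu, rfl⟩
    refine ⟨![t, v, u], ⟨by simpa using ht, by simpa using hv, by simpa using hu⟩, ?_⟩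
    rfl

/-- Points of the nested sector. -/
theorem npt_mem_nsector {z₁ d Q S : Fin 3 → ℝ} {δt δ : ℝ} {J : Set ℝ} {t v u : ℝ}
    (ht : t ∈ Ioo 0 δt) (hv : v ∈ Ioo 0 δ) (hu : u ∈ J) :
    npt z₁ d Q S t v u ∈ nsector z₁ d Q S δt δ J :=
  (mem_nsector_iff z₁ d Q S δt δ J _).2 ⟨t, ht, v, hv, u, hu, rfl⟩

/-- Nested sectors are monotone in the parameters. -/
theorem nsector_mono {z₁ d Q S : Fin 3 → ℝ} {δt δt' δ δ' : ℝ} (hδt : δt ≤ δt') (hδ : δ ≤ δ')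
    {J J' : Set ℝ} (hJ : J ⊆ J') : nsector z₁ d Q S δt δ J ⊆ nsector z₁ d Q S δt' δ' J' := by
  intro z hz
  obtain ⟨t, ht, v, hv, u, hu, rfl⟩ := (mem_nsector_iff z₁ d Q S δt δ J z).1 hz
  exact npt_mem_nsector ⟨ht.1, ht.2.trans_le hδt⟩ ⟨hv.1, hv.2.trans_le hδ⟩ (hJ hu)

/-- The blow-up point is jointly continuous in `(t, v, u)`. -/
theorem continuous_npt (z₁ d Q S : Fin 3 → ℝ) :
    Continuous fun p : ℝ × ℝ × ℝ => npt z₁ d Q S p.1 p.2.1 p.2.2 := by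
  refine continuous_pi fun i => ?_
  simp only [npt]
  fun_prop

/-! ### The sector integral in blown-up coordinates -/

/-- The product chart `ℝ³ ≅ ℝ² × ℝ` (`SepThree.chart3` without shear) in coordinates. -/
theorem chart3_zero_apply (w : Fin 3 → ℝ) :
    SepThree.chart3 (0, 0, 0) w = (![w 0, w 1], w 2) := by
  rw [SepThree.chart3_apply]
  have hb : SepThree.bse w = ![w 0, w 1] := by
    funext i
    fin_cases i <;> rfl
  have ha : SepThree.affv (0, 0, 0) (SepThree.bse w) = 0 := by simp [SepThree.affv]
  rw [ha, sub_zero, hb]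
  rfl

/-- **The nested-sector integral in blown-up coordinates.** See the module docstring. -/
theorem lintegral_nsector (z₁ d Q S : Fin 3 → ℝ) (hdet : det3 d Q S ≠ 0) (δt δ : ℝ)
    {J : Set ℝ} (hJ : MeasurableSet J) (G : (Fin 3 → ℝ) → ℝ≥0∞) (hG : Measurable G) :
    ∫⁻ z in nsector z₁ d Q S δt δ J, G z = ENNReal.ofReal |det3 d Q S| *
      ∫⁻ t in Ioo 0 δt, ∫⁻ v in Ioo 0 δ, ∫⁻ u in J,
        ENNReal.ofReal (t ^ 2 * v) * G (npt z₁ d Q S t v u) := by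
  have hd : ∀ w ∈ nbox δt δ J, HasFDerivWithinAt (nchart z₁ d Q S) (nderiv d Q S w) (nbox δt δ J) w :=
    fun w _ => (hasFDerivAt_nchart z₁ d Q S w).hasFDerivWithinAt
  rw [nsector, lintegral_image_eq_lintegral_abs_det_fderiv_mul volume (measurableSet_nbox δt δ hJ) hd
    (nchart_injOn z₁ d Q S hdet δt δ J) G]
  -- the integrand on the box
  set K : (Fin 2 → ℝ) × ℝ → ℝ≥0∞ := fun p =>
    ENNReal.ofReal (p.1 0 ^ 2 * p.1 1) * G (npt z₁ d Q S (p.1 0) (p.1 1) p.2) with hK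
  have hKm : Measurable K := by
    refine Measurable.mul (ENNReal.measurable_ofReal.comp ?_) (hG.comp ?_)
    · exact (((measurable_pi_apply 0).comp measurable_fst).pow_const 2).mul
        ((measurable_pi_apply 1).comp measurable_fst)
    · have hc : Continuous fun p : (Fin 2 → ℝ) × ℝ => npt z₁ d Q S (p.1 0) (p.1 1) p.2 :=
        continuous_pi fun i => by simp only [npt]; fun_prop
      exact hc.measurable
  set e := SepThree.chart3 (0, 0, 0) with he
  have h1 : ∫⁻ w in nbox δt δ J, ENNReal.ofReal |(nderiv d Q S w).det| * G (nchart z₁ d Q S w) =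
      ∫⁻ w in nbox δt δ J, ENNReal.ofReal |det3 d Q S| * K (e w) := by
    refine setLIntegral_congr_fun (measurableSet_nbox δt δ hJ) fun w hw => ?_
    rw [det_nderiv, he, chart3_zero_apply, hK]
    simp only [Matrix.cons_val_zero, Matrix.cons_val_one]
    rw [abs_mul, ENNReal.ofReal_mul (abs_nonneg _), abs_of_pos (mul_pos (pow_pos hw.1.1 2) hw.2.1.1)]
    rw [nchart]
    ring
  rw [h1, lintegral_const_mul' _ _ ENNReal.ofReal_ne_top]
  congr 1
  -- the box as a preimage of a product
  set B₂ : Set (Fin 2 → ℝ) := {z | z 0 ∈ Ioo 0 δt ∧ (z 1 - (fun _ : ℝ => (0 : ℝ)) (z 0)) /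
    (fun _ : ℝ => (1 : ℝ)) (z 0) ∈ Ioo 0 δ} with hB₂
  have hpre : nbox δt δ J = e ⁻¹' (B₂ ×ˢ J) := by
    ext w
    simp only [nbox, mem_setOf_eq, mem_preimage, he, chart3_zero_apply, mem_prod, hB₂,
      Matrix.cons_val_zero, Matrix.cons_val_one, sub_zero, div_one]
    tauto
  rw [hpre, (SepThree.measurePreserving_chart3 (0, 0, 0)).setLIntegral_comp_preimage_emb
    e.measurableEmbedding K (B₂ ×ˢ J), Measure.volume_eq_prod,
    setLIntegral_prod K (hKm.aemeasurable)]
  -- the planar box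
  have hΦm : Measurable fun w' : Fin 2 → ℝ => ∫⁻ u in J, K (w', u) := by
    have h := hKm.lintegral_prod_right' (ν := (volume : Measure ℝ).restrict J)
    exact h
  rw [hB₂, lintegral_chart measurableSet_Ioo measurableSet_Ioo measurable_const measurable_const
    (fun x _ => one_ne_zero) _ hΦm]
  refine setLIntegral_congr_fun measurableSet_Ioo fun t _ => ?_
  rw [abs_one, ENNReal.ofReal_one, one_mul]
  refine lintegral_congr fun v => lintegral_congr fun u => ?_
  simp [hK]

/-- The nested-sector integral with `J = [0, ε)`: the wall `u = 0` is null. -/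
theorem lintegral_nsector_Ico (z₁ d Q S : Fin 3 → ℝ) (hdet : det3 d Q S ≠ 0) (δt δ ε : ℝ)
    (G : (Fin 3 → ℝ) → ℝ≥0∞) (hG : Measurable G) :
    ∫⁻ z in nsector z₁ d Q S δt δ (Ico 0 ε), G z = ENNReal.ofReal |det3 d Q S| *
      ∫⁻ t in Ioo 0 δt, ∫⁻ v in Ioo 0 δ, ∫⁻ u in Ioo 0 ε,
        ENNReal.ofReal (t ^ 2 * v) * G (npt z₁ d Q S t v u) := by
  rw [lintegral_nsector z₁ d Q S hdet δt δ measurableSet_Ico G hG]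
  congr 1
  refine lintegral_congr fun t => lintegral_congr fun v => ?_
  rw [setLIntegral_congr Ioo_ae_eq_Ico]

end SepHHK

/-- **The nested thin-sector integral in blown-up coordinates** (registered part of
`stub_separateHigh`, base dimension `3` with fibres; literal form of `SepHHK.lintegral_nsector`):
for a frame `d, Q, S` of `ℝ³` and a measurable slope set `J`, the lower integral of a measurable
`G` over the nested thin sector `{z₁ + t (d + v (Q + u S)) | t ∈ (0, δt), v ∈ (0, δ), u ∈ J}` is
`|det(d, Q, S)| ∫⁻_t ∫⁻_v ∫⁻_u t² v · G(z₁ + t (d + v (Q + u S)))`. -/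
theorem separateThreeHHK_chart (z₁ d Q S : Fin 3 → ℝ) (hdet : SepHHK.det3 d Q S ≠ 0) (δt δ : ℝ) (J : Set ℝ) (hJ : MeasurableSet J) (G : (Fin 3 → ℝ) → ENNReal) (hG : Measurable G) : MeasureTheory.lintegral (MeasureTheory.volume.restrict ((fun w : Fin 3 → ℝ => fun i => z₁ i + w 0 * (d i + w 1 * (Q i + w 2 * S i))) '' {w : Fin 3 → ℝ | w 0 ∈ Set.Ioo 0 δt ∧ w 1 ∈ Set.Ioo 0 δ ∧ w 2 ∈ J})) G = ENNReal.ofReal |SepHHK.det3 d Q S| * MeasureTheory.lintegral (MeasureTheory.volume.restrict (Set.Ioo 0 δt)) (fun t => MeasureTheory.lintegral (MeasureTheory.volume.restrict (Set.Ioo 0 δ)) (fun v => MeasureTheory.lintegral (MeasureTheory.volume.restrict J) (fun u => ENNReal.ofReal (t ^ 2 * v) * G (fun i => z₁ i + t * (d i + v * (Q i + u * S i)))))) := by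
  exact SepHHK.lintegral_nsector z₁ d Q S hdet δt δ hJ G hG

end Summit.KontsevichZagierPeriods.ArrangementNormalForm.JanusBands
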